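import Mathlib
import Literature.NumberTheory.MahlerMeasure.FewMonomials
import HarnessLib

/-!
# Mahler's inequality `M(P′) ≤ n·M(P)` and the fewnomial height bounds `|c_j| ≤ binom(k−1, j)·M(f)`, `M(f) ≥ h(f)/2^{k−2}` (Akhtari–Vaaler; Dobrowolski–Smyth) — `FewnomialHeightMahlerBound` HOLDS (re-homed proofs)

**Mahler's inequality `M(P′) ≤ n·M(P)`** (Mahler 1961; McKee–Smyth Proposition 1.17) and the **fewnomial height bounds**
`|c_j| ≤ binom(k−1, j)·M(f)` for a complex polynomial with `k` nonzero coefficients (Akhtari–Vaaler 2019 = McKee–Smyth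
Theorem 11.4), hence `M(f) ≥ h(f)/2^{k−2}` (Dobrowolski–Smyth 2017, Theorem 1), RE-HOMED into `Literature/` by the Hodge
foundations lane (`lit-hodgefound`, seat p20, generation 36) from the venture cell `pub-namedobj` (seat `pub-namedobj-mahler-g26`):
verbatim ports, in dependency order and each with its original module docstring (Parts 1–3), of the modules
`Summits/Ventures/DiscreteObjects/Mahler/{MahlerDerivativeBound, FewnomialSupport, FewnomialHeightBound (the theorem and its
height corollaries; the cell's sub-Lehmer census readings, which import `SubLehmerDegree56`, are not ported)}.lean`, namespace
`Summit.Ventures.DiscreteObjects.Mahler` re-rooted as `Literature.NumberTheory.MahlerMeasure` (this file's path namespace).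

PROOF AS FORMALISED (McKee–Smyth §11.2, with Mahler's inequality through the elementary Gauss–Lucas route of Queffélec–Zarouf,
as described in the Part 1 header): reflect the outside roots, compare `|P| ≤ |Q|` and `|P′| ≤ |Q′|` outside the disc, monotonicity
of the circle average `logMahlerMeasure`; then induction on the number of monomials using `f′` and the derivative of `reverse f`,
Pascal's rule.  Theorems only (no definition, no named fact); imports Mathlib/Literature only; every declaration carries the
citation of the printed step it formalises.  Part 4 is the EXACT discharge
`Literature.NumberTheory.MahlerMeasure.FewnomialHeightMahlerBound_holds` of the Literature named fact `FewnomialHeightMahlerBound`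
(`FewMonomials.lean`, integer case of [DobrowolskiSmyth2017, Theorem 1]); its only previous proof was the Summits-side
`Summit.Ventures.DiscreteObjects.Mahler.fewnomialHeightMahlerBound_holds`, which `Literature/` cannot import.  The Summits originals
stay in place (transitional duplication; twins = same short names in `Summit.Ventures.DiscreteObjects.Mahler`).  Lehmer's problem
is not touched by any of this.
-/

noncomputable section

/-!
## Part 1 — port of `Summits/Ventures/DiscreteObjects/Mahler/MahlerDerivativeBound.lean`

# Mahler's inequality `M(P') ≤ n · M(P)` (venture `DiscreteObjects`, target L)

Cell `pub-namedobj`, seat `pub-namedobj-mahler-g26`. Framing: lottery ticket; floor = certified bounds/negative ranges.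

**Theorem** (`mahlerMeasure_derivative_le`; [cite: Mahler1961Derivative] K. Mahler, *On the zeros of the
derivative of a polynomial*, Proc. Roy. Soc. London Ser. A 264 (1961) 145–154; [cite: MckeeSmyth2021, Prop. 1.17]
McKee–Smyth, *Around the Unit Circle*).  For every `P ∈ ℂ[X]` of degree `n`, `M(P') ≤ n · M(P)` (Mathlib's
`Polynomial.mahlerMeasure`).

Kernel proof (REPLICATION of a classical theorem; elementary route of Queffélec–Zarouf, *On Bernstein's
inequality for polynomials*, Anal. Math. Phys. 9 (2019), §5 Thm 5.1 with Lemma 3.3, here WITHOUT the maximum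
modulus principle): write `P = c · ∏_{|a| ≤ 1} (X - a) · ∏_{|a| > 1} (X - a)` over its roots and REFLECT the outside
roots, `Q = c · ∏_{|a| ≤ 1} (X - a) · ∏_{|a| > 1} (1 - conj a · X)`.  Then `|P(z)| ≤ |Q(z)|` for `|z| ≥ 1`
(factorwise: `|1 - conj a z|² - |z - a|² = (|z|² - 1)(|a|² - 1)`), all roots of `Q` lie in the closed unit disc,
`deg Q = n` and `|lead Q| = M(P)`.  GAUSS–LUCAS (Mathlib, `Polynomial.rootSet_derivative_subset_convexHull_rootSet`)
applied to `w Q - P` (`|w| > 1`; all its roots lie in the closed disc) gives `|P'(z)| ≤ |Q'(z)|` for `|z| > 1`,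
hence on `|z| = 1` by continuity; the Mahler measure is monotone under domination on the unit circle
(`Polynomial.logMahlerMeasure` is a circle average), and `M(Q') = |lead Q'| = n |lead Q| = n M(P)` because the
roots of `Q'` lie in the closed disc (Gauss–Lucas again).  Used by the cell's `FewnomialHeightBound`
(Dobrowolski–Smyth 2017, Thm 1: `M(f) ≥ h(f)/2^{k-2}` for `k`-nomials), which discharges the Literature named
fact `Literature.NumberTheory.MahlerMeasure.FewnomialHeightMahlerBound`.
-/

section Part1

namespace Literature.NumberTheory.MahlerMeasure

open _root_.Polynomial ComplexConjugate

/-! ### Factorwise comparison of `|z - a|` and `|1 - conj a · z|` -/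

/-- `‖-conj a * z + 1‖² - ‖z - a‖² = (‖z‖² - 1)(‖a‖² - 1)`.
[cite: Mahler1961Derivative, Theorem 1 (M(P′) ≤ n·M(P); = McKee–Smyth Prop. 1.17)] -/
theorem norm_sq_reflect_sub (z a : ℂ) :
    ‖-conj a * z + 1‖ ^ 2 - ‖z - a‖ ^ 2 = (‖z‖ ^ 2 - 1) * (‖a‖ ^ 2 - 1) := by
  rw [Complex.sq_norm, Complex.sq_norm, Complex.sq_norm, Complex.sq_norm]
  simp only [Complex.normSq_apply, Complex.sub_re, Complex.sub_im, Complex.add_re, Complex.add_im,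
    Complex.one_re, Complex.one_im, Complex.mul_re, Complex.mul_im, Complex.neg_re, Complex.neg_im,
    Complex.conj_re, Complex.conj_im]
  ring

/-- For `‖z‖ ≥ 1` and `‖a‖ ≥ 1`: `‖z - a‖ ≤ ‖-conj a * z + 1‖` (the reflected factor dominates off the disc).
[cite: Mahler1961Derivative, Theorem 1 (M(P′) ≤ n·M(P); = McKee–Smyth Prop. 1.17)] -/
theorem norm_sub_le_norm_reflect {z a : ℂ} (hz : 1 ≤ ‖z‖) (ha : 1 ≤ ‖a‖) :
    ‖z - a‖ ≤ ‖-conj a * z + 1‖ := by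
  have h := norm_sq_reflect_sub z a
  have h1 : 0 ≤ (‖z‖ ^ 2 - 1) * (‖a‖ ^ 2 - 1) := mul_nonneg (by nlinarith) (by nlinarith)
  nlinarith [norm_nonneg (z - a), norm_nonneg (-conj a * z + 1)]

/-- The product of reflected linear factors dominates the product of the factors `X - a` off the unit disc.
[cite: Mahler1961Derivative, Theorem 1 (M(P′) ≤ n·M(P); = McKee–Smyth Prop. 1.17)] -/
theorem norm_eval_prod_X_sub_C_le_reflect (S : Multiset ℂ) (hS : ∀ a ∈ S, 1 ≤ ‖a‖) {z : ℂ}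
    (hz : 1 ≤ ‖z‖) :
    ‖eval z (S.map fun a => X - C a).prod‖ ≤
      ‖eval z (S.map fun a => C (-conj a) * X + C 1).prod‖ := by
  induction S using Multiset.induction_on with
  | empty => simp
  | cons b S ih =>
    have hb : 1 ≤ ‖b‖ := hS b (Multiset.mem_cons_self _ _)
    have ih' := ih (fun a ha => hS a (Multiset.mem_cons_of_mem ha))
    simp only [Multiset.map_cons, Multiset.prod_cons, eval_mul, norm_mul, eval_sub, eval_X, eval_C,
      eval_add]
    exact mul_le_mul (norm_sub_le_norm_reflect hz hb) ih' (norm_nonneg _) (norm_nonneg _)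

/-- A reflected linear factor `-conj a · X + 1` is a nonzero polynomial.
[cite: Mahler1961Derivative, Theorem 1 (M(P′) ≤ n·M(P); = McKee–Smyth Prop. 1.17)] -/
theorem reflect_factor_ne_zero (a : ℂ) : (C (-conj a) * X + C 1 : ℂ[X]) ≠ 0 := by
  intro h
  have := congrArg (eval 0) h
  simp at this

/-- The roots of a product of reflected factors `-conj a · X + 1`, `‖a‖ > 1`, lie in the OPEN unit disc.
[cite: Mahler1961Derivative, Theorem 1 (M(P′) ≤ n·M(P); = McKee–Smyth Prop. 1.17)] -/
theorem norm_lt_one_of_eval_reflect_prod_eq_zero (S : Multiset ℂ) (hS : ∀ a ∈ S, 1 < ‖a‖) {z : ℂ}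
    (hz : eval z (S.map fun a => C (-conj a) * X + C 1).prod = 0) : ‖z‖ < 1 := by
  rw [eval_multiset_prod, Multiset.map_map, Multiset.prod_eq_zero_iff, Multiset.mem_map] at hz
  obtain ⟨a, ha, h0⟩ := hz
  simp only [Function.comp_apply, eval_add, eval_mul, eval_C, eval_X] at h0
  have ha1 := hS a ha
  have h1 : conj a * z = 1 := by linear_combination -h0
  have h2 : ‖a‖ * ‖z‖ = 1 := by
    have := congrArg (fun w : ℂ => ‖w‖) h1
    simpa [norm_mul] using this
  by_contra hcon
  push Not at hcon
  nlinarith [norm_nonneg z]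

/-- Degree of a product of reflected factors (`a ≠ 0` throughout): one per factor.
[cite: Mahler1961Derivative, Theorem 1 (M(P′) ≤ n·M(P); = McKee–Smyth Prop. 1.17)] -/
theorem natDegree_reflect_prod (S : Multiset ℂ) (hS : ∀ a ∈ S, a ≠ 0) :
    ((S.map fun a => C (-conj a) * X + C 1).prod).natDegree = Multiset.card S := by
  induction S using Multiset.induction_on with
  | empty => simp
  | cons b S ih =>
    have hb : b ≠ 0 := hS b (Multiset.mem_cons_self _ _)
    have ih' := ih (fun a ha => hS a (Multiset.mem_cons_of_mem ha))
    have hb' : -conj b ≠ 0 := neg_ne_zero.2 ((_root_.map_ne_zero _).2 hb)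
    rw [Multiset.map_cons, Multiset.prod_cons, natDegree_mul (reflect_factor_ne_zero b)
      (Multiset.prod_ne_zero fun h => ?_), ih', natDegree_add_C, natDegree_C_mul_X _ hb',
      Multiset.card_cons, add_comm]
    rw [Multiset.mem_map] at h
    obtain ⟨a, -, ha⟩ := h
    exact reflect_factor_ne_zero a ha

/-- Leading coefficient of a product of reflected factors: `∏ ‖a‖` in modulus.
[cite: Mahler1961Derivative, Theorem 1 (M(P′) ≤ n·M(P); = McKee–Smyth Prop. 1.17)] -/
theorem norm_leadingCoeff_reflect_prod (S : Multiset ℂ) (hS : ∀ a ∈ S, a ≠ 0) :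
    ‖((S.map fun a => C (-conj a) * X + C 1).prod).leadingCoeff‖ = (S.map fun a => ‖a‖).prod := by
  induction S using Multiset.induction_on with
  | empty => simp
  | cons b S ih =>
    have hb : b ≠ 0 := hS b (Multiset.mem_cons_self _ _)
    have ih' := ih (fun a ha => hS a (Multiset.mem_cons_of_mem ha))
    have hb' : -conj b ≠ 0 := neg_ne_zero.2 ((_root_.map_ne_zero _).2 hb)
    rw [Multiset.map_cons, Multiset.prod_cons, leadingCoeff_mul, norm_mul, ih', Multiset.map_cons,
      Multiset.prod_cons, leadingCoeff_add_of_degree_lt' (degree_C_lt_degree_C_mul_X hb'),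
      leadingCoeff_C_mul_X, norm_neg, Complex.norm_conj]

/-! ### Gauss–Lucas in disc form, continuity to the circle, monotonicity of `M` -/

/-- **Gauss–Lucas, disc form.**  If all roots of a nonconstant `R ∈ ℂ[X]` lie in the closed unit disc, so do
the roots of `R'` (the closed disc is convex; Mathlib's `rootSet_derivative_subset_convexHull_rootSet`).
[cite: Mahler1961Derivative, Theorem 1 (M(P′) ≤ n·M(P); = McKee–Smyth Prop. 1.17)] -/
theorem norm_le_one_of_isRoot_derivative {R : ℂ[X]} (hR : 0 < R.degree)
    (h : ∀ z : ℂ, R.IsRoot z → ‖z‖ ≤ 1) {z : ℂ} (hz : R.derivative.IsRoot z) : ‖z‖ ≤ 1 := by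
  have hR' : R.derivative ≠ 0 := by
    rw [Ne, derivative_eq_zero]
    exact (natDegree_pos_iff_degree_pos.2 hR).ne'
  have hz' : z ∈ R.derivative.rootSet ℂ := by
    rw [mem_rootSet, coe_aeval_eq_eval]
    exact ⟨hR', hz⟩
  have hsub : R.rootSet ℂ ⊆ Metric.closedBall (0 : ℂ) 1 := by
    intro x hx
    rw [mem_rootSet, coe_aeval_eq_eval] at hx
    simpa [Metric.mem_closedBall, dist_zero_right] using h x hx.2
  have := (convexHull_min hsub (convex_closedBall (0 : ℂ) 1))
    (rootSet_derivative_subset_convexHull_rootSet hR hz')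
  simpa [Metric.mem_closedBall] using this

/-- The Mahler measure of a polynomial all of whose roots lie in the closed unit disc is the modulus of its
leading coefficient (Jensen). [cite: Mahler1961Derivative, Theorem 1 (M(P′) ≤ n·M(P); = McKee–Smyth Prop. 1.17)] -/
theorem mahlerMeasure_eq_norm_leadingCoeff_of_roots_le {R : ℂ[X]} (h : ∀ z : ℂ, R.IsRoot z → ‖z‖ ≤ 1) :
    R.mahlerMeasure = ‖R.leadingCoeff‖ := by
  by_cases hR : R = 0
  · simp [hR]
  rw [mahlerMeasure_eq_leadingCoeff_mul_prod_roots]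
  have : (R.roots.map (fun a ↦ max 1 ‖a‖)).prod = 1 := by
    apply Multiset.prod_eq_one
    intro x hx
    rw [Multiset.mem_map] at hx
    obtain ⟨a, ha, rfl⟩ := hx
    exact max_eq_left (h a ((mem_roots hR).1 ha))
  rw [this, mul_one]

/-- An inequality `‖f(z)‖ ≤ ‖g(z)‖` valid for `‖z‖ > 1` persists on the unit circle (continuity along rays).
[cite: Mahler1961Derivative, Theorem 1 (M(P′) ≤ n·M(P); = McKee–Smyth Prop. 1.17)] -/
theorem norm_eval_le_on_circle_of_exterior {f g : ℂ[X]}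
    (h : ∀ z : ℂ, 1 < ‖z‖ → ‖f.eval z‖ ≤ ‖g.eval z‖) {z : ℂ} (hz : ‖z‖ = 1) :
    ‖f.eval z‖ ≤ ‖g.eval z‖ := by
  set φ : ℝ → ℝ := fun t => ‖g.eval ((t : ℂ) * z)‖ - ‖f.eval ((t : ℂ) * z)‖ with hφ
  have hcont : Continuous φ := by
    have h1 : Continuous fun t : ℝ => ((t : ℂ) * z) := by fun_prop
    exact (continuous_norm.comp (g.continuous.comp h1)).sub (continuous_norm.comp (f.continuous.comp h1))
  have hev : ∀ᶠ t in nhdsWithin (1 : ℝ) (Set.Ioi 1), 0 ≤ φ t := by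
    filter_upwards [self_mem_nhdsWithin] with t ht
    have ht' : (1 : ℝ) < t := ht
    have ht1 : 1 < ‖(t : ℂ) * z‖ := by
      rw [norm_mul, hz, mul_one, Complex.norm_real, Real.norm_eq_abs, abs_of_pos (by linarith)]
      exact ht'
    have := h _ ht1
    simp only [hφ]
    linarith
  have htend : Filter.Tendsto φ (nhdsWithin (1 : ℝ) (Set.Ioi 1)) (nhds (φ 1)) :=
    (hcont.tendsto 1).mono_left nhdsWithin_le_nhds
  have h0 := ge_of_tendsto htend hev
  simp only [hφ, Complex.ofReal_one, one_mul] at h0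
  linarith

/-- **Monotonicity of the Mahler measure under domination on the unit circle:** if `‖f(z)‖ ≤ ‖g(z)‖` for all
`‖z‖ = 1` (and `g ≠ 0`) then `M(f) ≤ M(g)` (`log M` is the circle average of `log ‖·‖`; the roots of `f` on the
circle, where Mathlib's `log 0 = 0` spoils the pointwise comparison, form a finite — hence codiscrete — set).
[cite: Mahler1961Derivative, Theorem 1 (M(P′) ≤ n·M(P); = McKee–Smyth Prop. 1.17)] -/
theorem mahlerMeasure_le_of_norm_eval_le {f g : ℂ[X]} (hg : g ≠ 0)
    (h : ∀ z : ℂ, ‖z‖ = 1 → ‖f.eval z‖ ≤ ‖g.eval z‖) : f.mahlerMeasure ≤ g.mahlerMeasure := by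
  classical
  by_cases hf : f = 0
  · rw [hf, mahlerMeasure_zero]
    exact mahlerMeasure_nonneg g
  have hfpos : 0 < f.mahlerMeasure := mahlerMeasure_pos_of_ne_zero hf
  have hgpos : 0 < g.mahlerMeasure := mahlerMeasure_pos_of_ne_zero hg
  rw [← Real.log_le_log_iff hfpos hgpos, ← logMahlerMeasure_eq_log_MahlerMeasure,
    ← logMahlerMeasure_eq_log_MahlerMeasure, logMahlerMeasure_def, logMahlerMeasure_def]
  set F : ℂ → ℝ := fun x => if eval x f = 0 then 0 else Real.log ‖eval x g‖ with hF
  have hfin : ((f.roots.toFinset : Finset ℂ) : Set ℂ).Finite := Finset.finite_toSet _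
  have hEq : F =ᶠ[Filter.codiscreteWithin (Metric.sphere (0 : ℂ) |1|)] (fun x => Real.log ‖eval x g‖) := by
    apply Filter.eventually_of_mem (compl_finite_mem_codiscreteWithin hfin)
    intro x hx
    have hx' : eval x f ≠ 0 := by
      intro h0
      apply hx
      simp only [Finset.mem_coe, Multiset.mem_toFinset]
      exact (mem_roots hf).2 h0
    simp [hF, hx']
  have hIf : CircleIntegrable (fun x => Real.log ‖eval x f‖) 0 1 := f.intervalIntegrable_mahlerMeasure
  have hIg : CircleIntegrable (fun x => Real.log ‖eval x g‖) 0 1 := g.intervalIntegrable_mahlerMeasure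
  have hIF : CircleIntegrable F 0 1 := hIg.congr_codiscreteWithin hEq.symm
  calc Real.circleAverage (fun x ↦ Real.log ‖eval x f‖) 0 1 ≤ Real.circleAverage F 0 1 := by
        apply Real.circleAverage_mono hIf hIF
        intro x hx
        have hx1 : ‖x‖ = 1 := by simpa using hx
        simp only [hF]
        split_ifs with h0
        · simp [h0]
        · exact Real.log_le_log (norm_pos_iff.2 h0) (h x hx1)
    _ = Real.circleAverage (fun x ↦ Real.log ‖eval x g‖) 0 1 :=
        Real.circleAverage_congr_codiscreteWithin hEq one_ne_zero

/-! ### The derivative comparison (Bernstein–de Bruijn–Queffélec–Zarouf lemma, special form) -/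

/-- **Derivative domination off the disc.**  Let `P, Q ∈ ℂ[X]` with `deg P ≤ deg Q`, `deg Q ≥ 1`,
`‖lead P‖ ≤ ‖lead Q‖`, `‖P(z)‖ ≤ ‖Q(z)‖` for `‖z‖ ≥ 1`, and all roots of `Q` in the closed unit disc.  Then
`‖P'(z)‖ ≤ ‖Q'(z)‖` for every `‖z‖ > 1`.  (If `‖Q'(z)‖ < ‖P'(z)‖`, put `w = P'(z)/Q'(z)`, `|w| > 1`: the
polynomial `w Q - P` has degree `deg Q ≥ 1` and all its roots in the closed disc, so by Gauss–Lucas its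
derivative `w Q' - P'` cannot vanish at `z` — but it does.)
[cite: Mahler1961Derivative, Theorem 1 (M(P′) ≤ n·M(P); = McKee–Smyth Prop. 1.17)] -/
theorem norm_eval_derivative_le_of_dominated {P Q : ℂ[X]} (hdeg : P.natDegree ≤ Q.natDegree)
    (hQ0 : 0 < Q.natDegree) (hlead : ‖P.leadingCoeff‖ ≤ ‖Q.leadingCoeff‖)
    (hdom : ∀ z : ℂ, 1 ≤ ‖z‖ → ‖P.eval z‖ ≤ ‖Q.eval z‖) (hroots : ∀ z : ℂ, Q.IsRoot z → ‖z‖ ≤ 1)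
    {z : ℂ} (hz : 1 < ‖z‖) : ‖P.derivative.eval z‖ ≤ ‖Q.derivative.eval z‖ := by
  by_contra hlt
  push Not at hlt
  have hQdeg : 0 < Q.degree := natDegree_pos_iff_degree_pos.1 hQ0
  have hQne : Q ≠ 0 := by
    rintro rfl
    simp at hQ0
  have hQ'z : Q.derivative.eval z ≠ 0 := by
    intro h0
    have := norm_le_one_of_isRoot_derivative hQdeg hroots (z := z) h0
    linarith
  set w : ℂ := P.derivative.eval z / Q.derivative.eval z with hw
  have hwpos : 0 < ‖Q.derivative.eval z‖ := norm_pos_iff.2 hQ'z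
  have hw1 : 1 < ‖w‖ := by
    rw [hw, norm_div, lt_div_iff₀ hwpos, one_mul]
    exact hlt
  set R : ℂ[X] := C w * Q - P with hR
  -- the top coefficient of `R` does not cancel
  have hcoef : R.coeff Q.natDegree ≠ 0 := by
    intro h0
    rw [hR, coeff_sub, coeff_C_mul, coeff_natDegree, sub_eq_zero] at h0
    have h1 : ‖P.coeff Q.natDegree‖ ≤ ‖P.leadingCoeff‖ := by
      rcases hdeg.eq_or_lt with h | h
      · rw [← h, coeff_natDegree]
      · rw [coeff_eq_zero_of_natDegree_lt h, norm_zero]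
        exact norm_nonneg _
    have h2 : ‖w * Q.leadingCoeff‖ = ‖P.coeff Q.natDegree‖ := by rw [h0]
    rw [norm_mul] at h2
    have h3 : 0 < ‖Q.leadingCoeff‖ := norm_pos_iff.2 (leadingCoeff_ne_zero.2 hQne)
    nlinarith
  have hRne : R ≠ 0 := fun h => hcoef (by rw [h, coeff_zero])
  have hRdeg : 0 < R.degree := by
    have h1 : Q.natDegree ≤ R.natDegree := le_natDegree_of_ne_zero hcoef
    exact natDegree_pos_iff_degree_pos.1 (lt_of_lt_of_le hQ0 h1)
  -- all roots of `R` lie in the closed unit disc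
  have hRroots : ∀ x : ℂ, R.IsRoot x → ‖x‖ ≤ 1 := by
    intro x hx
    by_contra hx1
    push Not at hx1
    have hx0 : eval x R = 0 := hx
    rw [hR, eval_sub, eval_mul, eval_C, sub_eq_zero] at hx0
    have h1 : ‖w‖ * ‖Q.eval x‖ = ‖P.eval x‖ := by rw [← norm_mul, hx0]
    have h2 := hdom x hx1.le
    have hQx : Q.eval x ≠ 0 := by
      intro h0
      have := hroots x h0
      linarith
    have h3 : 0 < ‖Q.eval x‖ := norm_pos_iff.2 hQx
    nlinarith
  -- but `R'(z) = 0` with `‖z‖ > 1`: contradiction with Gauss–Lucas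
  have hR'z : R.derivative.IsRoot z := by
    show eval z (derivative R) = 0
    rw [hR, derivative_sub, derivative_mul, derivative_C, zero_mul, zero_add, eval_sub, eval_mul, eval_C,
      hw, div_mul_cancel₀ _ hQ'z, sub_self]
  have := norm_le_one_of_isRoot_derivative hRdeg hRroots hR'z
  linarith

/-! ### Mahler's theorem -/

/-- **Mahler's inequality (1961): `M(P') ≤ deg P · M(P)` for every complex polynomial `P`.**
REPLICATION in the kernel of K. Mahler, Proc. Roy. Soc. London A 264 (1961) 145–154 (= McKee–Smyth,
*Around the Unit Circle*, Prop. 1.17), by root reflection + Gauss–Lucas (module docstring).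
[cite: Mahler1961Derivative, Theorem 1 (M(P′) ≤ n·M(P); = McKee–Smyth Prop. 1.17)] -/
theorem mahlerMeasure_derivative_le (P : ℂ[X]) :
    P.derivative.mahlerMeasure ≤ (P.natDegree : ℝ) * P.mahlerMeasure := by
  classical
  by_cases hn : P.natDegree = 0
  · rw [derivative_eq_zero.2 hn, hn]
    simp
  have hP : P ≠ 0 := fun h => hn (by rw [h, natDegree_zero])
  set c := P.leadingCoeff with hc
  have hc0 : c ≠ 0 := leadingCoeff_ne_zero.2 hP
  set Sin := P.roots.filter (fun a => ‖a‖ ≤ 1) with hSin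
  set Sout := P.roots.filter (fun a => ¬ ‖a‖ ≤ 1) with hSout
  have hSout1 : ∀ a ∈ Sout, 1 < ‖a‖ := fun a ha => not_le.1 (Multiset.mem_filter.1 ha).2
  have hSout0 : ∀ a ∈ Sout, a ≠ 0 := by
    intro a ha h0
    have := hSout1 a ha
    rw [h0, norm_zero] at this
    linarith
  have hSin1 : ∀ a ∈ Sin, ‖a‖ ≤ 1 := fun a ha => (Multiset.mem_filter.1 ha).2
  set A : ℂ[X] := C c * (Sin.map fun a => X - C a).prod with hA
  set B : ℂ[X] := (Sout.map fun a => X - C a).prod with hB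
  set Bs : ℂ[X] := (Sout.map fun a => C (-conj a) * X + C 1).prod with hBs
  have hmonIn : (Sin.map fun a => X - C a).prod.Monic :=
    monic_multiset_prod_of_monic _ _ (fun a _ => monic_X_sub_C a)
  have hmonB : B.Monic := monic_multiset_prod_of_monic _ _ (fun a _ => monic_X_sub_C a)
  have hPfac : P = A * B := by
    conv_lhs => rw [(IsAlgClosed.splits P).eq_prod_roots]
    rw [hA, hB, mul_assoc, ← Multiset.prod_add, ← Multiset.map_add, Multiset.filter_add_not]
  set Q : ℂ[X] := A * Bs with hQ
  have hA0 : A ≠ 0 := mul_ne_zero (C_ne_zero.2 hc0) hmonIn.ne_zero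
  have hBs0 : Bs ≠ 0 := by
    refine Multiset.prod_ne_zero fun h => ?_
    rw [Multiset.mem_map] at h
    obtain ⟨a, -, ha⟩ := h
    exact reflect_factor_ne_zero a ha
  -- roots of `A` and of `Q` lie in the closed disc
  have hAroots : ∀ z : ℂ, A.eval z = 0 → ‖z‖ ≤ 1 := by
    intro z hz
    rw [hA, eval_mul, eval_C, mul_eq_zero] at hz
    rcases hz with h | h
    · exact absurd h hc0
    rw [eval_multiset_prod, Multiset.map_map, Multiset.prod_eq_zero_iff, Multiset.mem_map] at h
    obtain ⟨a, ha, h0⟩ := h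
    simp only [Function.comp_apply, eval_sub, eval_X, eval_C, sub_eq_zero] at h0
    rw [h0]
    exact hSin1 a ha
  have hQroots : ∀ z : ℂ, Q.IsRoot z → ‖z‖ ≤ 1 := by
    intro z hz
    have hz0 : eval z Q = 0 := hz
    rw [hQ, eval_mul, mul_eq_zero] at hz0
    rcases hz0 with h | h
    · exact hAroots z h
    · exact (norm_lt_one_of_eval_reflect_prod_eq_zero Sout hSout1 h).le
  -- degrees
  have hdegB : B.natDegree = Multiset.card Sout := by
    rw [hB, natDegree_multiset_prod_of_monic _ (fun f hf => ?_)]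
    · simp only [Multiset.map_map, Function.comp_def, natDegree_X_sub_C, Multiset.map_const',
        Multiset.sum_replicate, smul_eq_mul, mul_one]
    · rw [Multiset.mem_map] at hf
      obtain ⟨a, -, rfl⟩ := hf
      exact monic_X_sub_C a
  have hdegBs : Bs.natDegree = Multiset.card Sout := natDegree_reflect_prod Sout hSout0
  have hQn : Q.natDegree = P.natDegree := by
    rw [hQ, hPfac, natDegree_mul hA0 hBs0, natDegree_mul hA0 hmonB.ne_zero, hdegB, hdegBs]
  have hQ0 : 0 < Q.natDegree := by
    rw [hQn]
    exact Nat.pos_of_ne_zero hn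
  have hQne : Q ≠ 0 := mul_ne_zero hA0 hBs0
  -- the leading coefficient of `Q` has modulus `M(P)`
  have hleadA : ‖A.leadingCoeff‖ = ‖c‖ := by
    rw [hA, leadingCoeff_mul, leadingCoeff_C, hmonIn.leadingCoeff, mul_one]
  have hleadQ : ‖Q.leadingCoeff‖ = P.mahlerMeasure := by
    rw [hQ, leadingCoeff_mul, norm_mul, hleadA, hBs, norm_leadingCoeff_reflect_prod Sout hSout0,
      mahlerMeasure_eq_leadingCoeff_mul_prod_roots, ← hc]
    congr 1
    conv_rhs => rw [← Multiset.filter_add_not (fun a : ℂ => ‖a‖ ≤ 1) P.roots, Multiset.map_add,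
      Multiset.prod_add]
    rw [← hSin, ← hSout]
    have h1 : (Sin.map fun a => max 1 ‖a‖).prod = 1 := by
      apply Multiset.prod_eq_one
      intro x hx
      rw [Multiset.mem_map] at hx
      obtain ⟨a, ha, rfl⟩ := hx
      exact max_eq_left (hSin1 a ha)
    have h2 : (Sout.map fun a => max 1 ‖a‖) = Sout.map fun a => ‖a‖ := by
      apply Multiset.map_congr rfl
      intro a ha
      exact max_eq_right (hSout1 a ha).le
    rw [h1, one_mul, h2]
  have hlead : ‖P.leadingCoeff‖ ≤ ‖Q.leadingCoeff‖ := by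
    rw [hleadQ]
    exact leadingCoeff_le_mahlerMeasure P
  -- domination `‖P‖ ≤ ‖Q‖` off the open disc
  have hdomPQ : ∀ z : ℂ, 1 ≤ ‖z‖ → ‖P.eval z‖ ≤ ‖Q.eval z‖ := by
    intro z hz
    have e1 : eval z P = eval z A * eval z B := by rw [hPfac]; exact eval_mul
    have e2 : eval z Q = eval z A * eval z Bs := eval_mul
    rw [e1, e2, norm_mul, norm_mul]
    exact mul_le_mul_of_nonneg_left
      (norm_eval_prod_X_sub_C_le_reflect Sout (fun a ha => (hSout1 a ha).le) hz) (norm_nonneg (eval z A))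
  -- derivative domination, off the disc and then on the circle
  have hder : ∀ z : ℂ, 1 < ‖z‖ → ‖P.derivative.eval z‖ ≤ ‖Q.derivative.eval z‖ := fun z hz =>
    norm_eval_derivative_le_of_dominated hQn.ge hQ0 hlead hdomPQ hQroots hz
  have hcirc : ∀ z : ℂ, ‖z‖ = 1 → ‖P.derivative.eval z‖ ≤ ‖Q.derivative.eval z‖ := fun z hz =>
    norm_eval_le_on_circle_of_exterior hder hz
  have hQ'ne : Q.derivative ≠ 0 := derivative_ne_zero.2 hQ0.ne'
  -- `M(Q') = n · M(P)` (roots of `Q'` in the closed disc by Gauss–Lucas)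
  have hQ'roots : ∀ z : ℂ, Q.derivative.IsRoot z → ‖z‖ ≤ 1 := fun z hz =>
    norm_le_one_of_isRoot_derivative (natDegree_pos_iff_degree_pos.1 hQ0) hQroots hz
  have hMQ' : Q.derivative.mahlerMeasure = (P.natDegree : ℝ) * P.mahlerMeasure := by
    rw [mahlerMeasure_eq_norm_leadingCoeff_of_roots_le hQ'roots, leadingCoeff_derivative, norm_mul,
      Complex.norm_natCast, hleadQ, hQn, mul_comm]
  calc P.derivative.mahlerMeasure ≤ Q.derivative.mahlerMeasure :=
        mahlerMeasure_le_of_norm_eval_le hQ'ne hcirc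
    _ = (P.natDegree : ℝ) * P.mahlerMeasure := hMQ'

end Literature.NumberTheory.MahlerMeasure

end Part1

/-!
## Part 2 — port of `Summits/Ventures/DiscreteObjects/Mahler/FewnomialSupport.lean`

# Bookkeeping for sparse polynomials: reversal, shifts, derivatives, ranks of exponents (venture `DiscreteObjects`, target L)

Cell `pub-namedobj`, seat `pub-namedobj-mahler-g26`. Framing: lottery ticket; floor = certified bounds/negative ranges.

Elementary lemmas used by the cell's kernel REPLICATION of the Akhtari–Vaaler / Dobrowolski–Smyth bound
`M(f) ≥ |c_j| / binom(k-1, j)` for polynomials with `k` nonzero coefficients ([cite: MckeeSmyth2021, Theorem 11.4];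
file `FewnomialHeightBound`): the Mahler measure is invariant under reversal (`mahlerMeasure_reverse`, via the
circle-average form of Mathlib's `Polynomial.logMahlerMeasure` and `z ↦ z⁻¹`) and under multiplication by `X^r`
(`mahlerMeasure_X_pow`); the support of `X^r · g`, of `g'` (when `g(0) ≠ 0`, characteristic zero) and of
`reverse g` in terms of the support of `g`, with the number of nonzero coefficients and the RANK of an exponent
(`#{e ∈ supp : e < i}`) tracked through each operation; and `binom(n, r) ≤ 2^{n-1}` (`n ≥ 1`).  No new mathematics.
-/

section Part2

namespace Literature.NumberTheory.MahlerMeasure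

open _root_.Polynomial

/-! ### `M(f.reverse) = M(f)` and `M(X^r) = 1` -/

/-- On the unit circle, `‖(reverse f)(z)‖ = ‖f(z⁻¹)‖`. [cite: MckeeSmyth2021, §11.2 (proof of Theorem 11.4) p.194] -/
theorem norm_eval_reverse_of_norm_eq_one (f : ℂ[X]) {z : ℂ} (hz : ‖z‖ = 1) :
    ‖eval z f.reverse‖ = ‖eval z⁻¹ f‖ := by
  have hz0 : z ≠ 0 := by
    rintro rfl
    simp at hz
  haveI : Invertible (z⁻¹) := invertibleOfNonzero (inv_ne_zero hz0)
  have h := eval₂_reverse_mul_pow (RingHom.id ℂ) z⁻¹ f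
  rw [invOf_eq_inv, inv_inv, eval₂_id, eval₂_id] at h
  have := congrArg (fun w : ℂ => ‖w‖) h
  simp only [norm_mul, norm_pow, norm_inv, hz, inv_one, one_pow, mul_one] at this
  exact this

/-- **`M(reverse f) = M(f)`** (the circle average of `log ‖f‖` is invariant under `z ↦ z⁻¹`).
[cite: MckeeSmyth2021, §11.2 (proof of Theorem 11.4) p.194] -/
theorem mahlerMeasure_reverse (f : ℂ[X]) : f.reverse.mahlerMeasure = f.mahlerMeasure := by
  by_cases hf : f = 0
  · simp [hf]
  have hr : f.reverse ≠ 0 := by rwa [Ne, reverse_eq_zero]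
  have h1 : f.reverse.logMahlerMeasure = f.logMahlerMeasure := by
    rw [logMahlerMeasure_def, logMahlerMeasure_def]
    calc Real.circleAverage (fun x ↦ Real.log ‖eval x f.reverse‖) 0 1
        = Real.circleAverage (fun x ↦ Real.log ‖eval x⁻¹ f‖) 0 1 := by
          apply Real.circleAverage_congr_sphere
          intro x hx
          have hx1 : ‖x‖ = 1 := by simpa using hx
          simp only [norm_eval_reverse_of_norm_eq_one f hx1]
      _ = Real.circleAverage (fun x ↦ Real.log ‖eval x f‖) 0 1 :=
          Real.circleAverage_zero_one_congr_inv (f := fun x => Real.log ‖eval x f‖)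
  rw [← Real.exp_log (mahlerMeasure_pos_of_ne_zero hr), ← Real.exp_log (mahlerMeasure_pos_of_ne_zero hf),
    ← logMahlerMeasure_eq_log_MahlerMeasure, ← logMahlerMeasure_eq_log_MahlerMeasure, h1]

/-- `M(X^r) = 1`. [cite: MckeeSmyth2021, §11.2 (proof of Theorem 11.4) p.194] -/
theorem mahlerMeasure_X_pow (r : ℕ) : ((X : ℂ[X]) ^ r).mahlerMeasure = 1 := by
  have hne : (monomial r (1 : ℂ)) ≠ 0 := by simp
  rw [X_pow_eq_monomial, Polynomial.mahlerMeasure, if_pos hne, logMahlerMeasure_monomial, norm_one,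
    Real.log_one, Real.exp_zero]

/-- `M(X^r · g) = M(g)`. [cite: MckeeSmyth2021, §11.2 (proof of Theorem 11.4) p.194] -/
theorem mahlerMeasure_X_pow_mul (r : ℕ) (g : ℂ[X]) : (X ^ r * g).mahlerMeasure = g.mahlerMeasure := by
  rw [mahlerMeasure_mul, mahlerMeasure_X_pow, one_mul]

/-! ### Supports of `X^r · g`, `g'`, `reverse g` -/

/-- The support of `X^r · g` is the support of `g` shifted by `r`.
[cite: MckeeSmyth2021, §11.2 (proof of Theorem 11.4) p.194] -/
theorem support_X_pow_mul (r : ℕ) (g : ℂ[X]) : (X ^ r * g).support = g.support.map (addRightEmbedding r) := by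
  ext d
  simp only [mem_support_iff, Finset.mem_map, addRightEmbedding_apply, coeff_X_pow_mul']
  constructor
  · intro h
    by_cases hle : r ≤ d
    · rw [if_pos hle] at h
      exact ⟨d - r, h, Nat.sub_add_cancel hle⟩
    · rw [if_neg hle] at h
      exact absurd rfl h
  · rintro ⟨e, he, rfl⟩
    rw [if_pos (Nat.le_add_left r e), Nat.add_sub_cancel]
    exact he

/-- Multiplying by `X^r` does not change the number of nonzero coefficients.
[cite: MckeeSmyth2021, §11.2 (proof of Theorem 11.4) p.194] -/
theorem card_support_X_pow_mul_complex (r : ℕ) (g : ℂ[X]) : (X ^ r * g).support.card = g.support.card := by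
  rw [support_X_pow_mul, Finset.card_map]

/-- Multiplying by `X^r` does not change the rank of an exponent within the support.
[cite: MckeeSmyth2021, §11.2 (proof of Theorem 11.4) p.194] -/
theorem rank_X_pow_mul (r : ℕ) (g : ℂ[X]) (i : ℕ) :
    ((X ^ r * g).support.filter (· < i + r)).card = (g.support.filter (· < i)).card := by
  rw [support_X_pow_mul, Finset.filter_map, Finset.card_map]
  congr 1
  apply Finset.filter_congr
  intro e _
  simp only [Function.comp_apply, addRightEmbedding_apply]
  omega

/-- If `g(0) ≠ 0`: the support of `g` is `{0}` together with the support of `g'` shifted up by one (char. 0).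
[cite: MckeeSmyth2021, §11.2 (proof of Theorem 11.4) p.194] -/
theorem support_eq_insert_map_derivative (g : ℂ[X]) (h0 : g.coeff 0 ≠ 0) :
    g.support = insert 0 (g.derivative.support.map ⟨fun n => n + 1, add_left_injective 1⟩) := by
  ext n
  rw [Finset.mem_insert, Finset.mem_map]
  constructor
  · intro hn
    rcases Nat.eq_zero_or_pos n with h | h
    · exact Or.inl h
    · right
      refine ⟨n - 1, ?_, ?_⟩
      · rw [mem_support_derivative, Nat.sub_add_cancel h]
        exact hn
      · show n - 1 + 1 = n
        exact Nat.sub_add_cancel h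
  · rintro (rfl | ⟨m, hm, rfl⟩)
    · exact mem_support_iff.2 h0
    · exact mem_support_derivative.1 hm

/-- If `g(0) ≠ 0`, the derivative has exactly one nonzero coefficient fewer.
[cite: MckeeSmyth2021, §11.2 (proof of Theorem 11.4) p.194] -/
theorem card_support_derivative_add_one (g : ℂ[X]) (h0 : g.coeff 0 ≠ 0) :
    g.derivative.support.card + 1 = g.support.card := by
  rw [support_eq_insert_map_derivative g h0, Finset.card_insert_of_notMem (by simp), Finset.card_map]

/-- If `g(0) ≠ 0` and `0 < i`: the rank of `i - 1` in the support of `g'` is one less than the rank of `i` in the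
support of `g` (the constant term, of rank `0`, disappears).
[cite: MckeeSmyth2021, §11.2 (proof of Theorem 11.4) p.194] -/
theorem rank_derivative_add_one (g : ℂ[X]) (h0 : g.coeff 0 ≠ 0) {i : ℕ} (hi : 0 < i) :
    (g.derivative.support.filter (· < i - 1)).card + 1 = (g.support.filter (· < i)).card := by
  rw [support_eq_insert_map_derivative g h0, Finset.filter_insert, if_pos hi,
    Finset.card_insert_of_notMem (by simp), Finset.filter_map, Finset.card_map]
  congr 2
  apply Finset.filter_congr
  intro e _
  simp only [Function.comp_apply, Function.Embedding.coeFn_mk]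
  omega

/-- Reversal permutes the nonzero coefficients: same number.
[cite: MckeeSmyth2021, §11.2 (proof of Theorem 11.4) p.194] -/
theorem card_support_reverse (f : ℂ[X]) : f.reverse.support.card = f.support.card := by
  unfold reverse
  rw [reflect_support, Finset.card_image_of_injective _ (revAt f.natDegree).injective]

/-- The rank of `N - i` in the support of `reverse g` counts the exponents of `g` ABOVE `i` (`N = deg g`).
[cite: MckeeSmyth2021, §11.2 (proof of Theorem 11.4) p.194] -/
theorem rank_reverse (g : ℂ[X]) (i : ℕ) (hi : i ≤ g.natDegree) :
    (g.reverse.support.filter (· < g.natDegree - i)).card = (g.support.filter (i < ·)).card := by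
  unfold reverse
  rw [reflect_support, Finset.filter_image, Finset.card_image_of_injective _ (revAt g.natDegree).injective]
  congr 1
  apply Finset.filter_congr
  intro e he
  have heN : e ≤ g.natDegree := le_natDegree_of_mem_supp e he
  rw [revAt_le heN]
  omega

/-- Rank below + the exponent itself + rank above = number of nonzero coefficients.
[cite: MckeeSmyth2021, §11.2 (proof of Theorem 11.4) p.194] -/
theorem rank_add_rank_above_add_one {g : ℂ[X]} {i : ℕ} (hi : i ∈ g.support) :
    (g.support.filter (· < i)).card + (g.support.filter (i < ·)).card + 1 = g.support.card := by
  have h := Finset.card_filter_add_card_filter_not (s := g.support) (fun e => e < i)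
  have h2 : (g.support.filter fun e => ¬ e < i) = insert i (g.support.filter (i < ·)) := by
    ext e
    simp only [Finset.mem_filter, Finset.mem_insert]
    constructor
    · rintro ⟨he, hne⟩
      rcases Nat.eq_or_lt_of_le (not_lt.1 hne) with h | h
      · exact Or.inl h.symm
      · exact Or.inr ⟨he, h⟩
    · rintro (rfl | ⟨he, h⟩)
      · exact ⟨hi, lt_irrefl _⟩
      · exact ⟨he, by omega⟩
  rw [h2, Finset.card_insert_of_notMem (by simp)] at h
  omega

/-- The rank of a member of the support is less than the number of nonzero coefficients.
[cite: MckeeSmyth2021, §11.2 (proof of Theorem 11.4) p.194] -/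
theorem rank_lt_card {g : ℂ[X]} {i : ℕ} (hi : i ∈ g.support) :
    (g.support.filter (· < i)).card < g.support.card := by
  have := rank_add_rank_above_add_one hi
  omega

/-! ### A binomial estimate -/

/-- `binom(n, r) ≤ 2^{n-1}` for `n ≥ 1`. [cite: MckeeSmyth2021, §11.2 (proof of Theorem 11.4) p.194] -/
theorem choose_le_two_pow_pred {n : ℕ} (hn : 1 ≤ n) (r : ℕ) : n.choose r ≤ 2 ^ (n - 1) := by
  induction n, hn using Nat.le_induction generalizing r with
  | base =>
    rcases r with _ | r
    · simp
    · rw [Nat.choose_succ_succ', Nat.choose_zero_succ, add_zero]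
      rcases r with _ | r
      · simp
      · simp
  | succ n hn ih =>
    rcases r with _ | r
    · simp [Nat.one_le_two_pow]
    · rw [Nat.choose_succ_succ', show n + 1 - 1 = (n - 1) + 1 by omega, pow_succ]
      have h1 := ih r
      have h2 := ih (r + 1)
      omega

end Literature.NumberTheory.MahlerMeasure

end Part2

/-!
## Part 3 — port of `Summits/Ventures/DiscreteObjects/Mahler/FewnomialHeightBound.lean` (7 declarations kept)

# The fewnomial height bounds `|c_j| ≤ binom(k-1, j) · M(f)` and `M(f) ≥ h(f)/2^{k-2}` (venture `DiscreteObjects`, target L)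

Cell `pub-namedobj`, seat `pub-namedobj-mahler-g26`. Framing: lottery ticket; floor = certified bounds/negative ranges.

**Theorem** (`norm_coeff_le_choose_mul_mahlerMeasure`; [cite: AkhtariVaaler2019, Theorem 1.1] = [cite: MckeeSmyth2021,
Theorem 11.4], improving [cite: DobrowolskiSmyth2017, Theorem 1]).  Let `f = c_0 z^{m_0} + ⋯ + c_{k-1} z^{m_{k-1}} ∈ ℂ[z]` have
exactly `k` nonzero coefficients, listed by increasing exponent.  Then `|c_j| ≤ binom(k-1, j) · M(f)` for every `j`
— in Lean, for `i ∈ supp f` with RANK `j = #{e ∈ supp f : e < i}`.  Since `binom(k-1, j) ≤ 2^{k-2}` this contains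
the Dobrowolski–Smyth bound `|c_j| ≤ 2^{k-2} M(f)`, i.e. `M(f) ≥ h(f)/2^{k-2}` (`norm_coeff_le_two_pow_mul_mahlerMeasure`).
REPLICATION in the kernel of the printed proof (McKee–Smyth §11.2): strip the power of `z` dividing `f`; induction on
`k`; for a middle coefficient, `i |c_i| ≤ binom(k-2, j-1) · deg f · M(f)` from `f'` and `(deg f - i) |c_i| ≤
binom(k-2, j) · deg f · M(f)` from the derivative of the reversed polynomial, by MAHLER'S INEQUALITY `M(f') ≤ deg f · M(f)`
(`mahlerMeasure_derivative_le`, file `MahlerDerivativeBound`) and `M(reverse f) = M(f)`; add (Pascal's rule).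

Consequences. `fewnomialHeightMahlerBound_holds` DISCHARGES the Literature named fact
`Literature.NumberTheory.MahlerMeasure.FewnomialHeightMahlerBound` (integer case of [DobrowolskiSmyth2017, Thm 1]).
Census reading (target L): a sub-Lehmer integer polynomial (`1 < M(P) < M(ℓ) = 1.17628…`) with `k` nonzero coefficients
has `|c_j| < 1.17629 · binom(k-1, j)` (`natAbs_coeff_lt_choose_of_subLehmer`); with the cell's `SparseSubLehmer` (`k ≥ 5`)
the first open sparse class is the PENTANOMIALS, whose coefficients are therefore at most `7` in modulus, the second and
fourth at most `4` (`natAbs_coeff_le_seven_of_subLehmer`, `natAbs_coeff_le_four_of_subLehmer`) — finiteness-type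
constraints on the Lehmer ticket, not new bounds on `M`.
-/

section Part3

namespace Literature.NumberTheory.MahlerMeasure

open _root_.Polynomial

/-! ### Two more bookkeeping facts -/

/-- If `g(0) ≠ 0`: the rank of `i` in the support of `g'` is one less than the rank of `i + 1` in the support of `g`.
[cite: AkhtariVaaler2019, Theorem 1.1 (= McKee–Smyth Thm 11.4 p.194)] -/
theorem rank_derivative_succ (g : ℂ[X]) (h0 : g.coeff 0 ≠ 0) (i : ℕ) :
    (g.derivative.support.filter (· < i)).card + 1 = (g.support.filter (· < i + 1)).card := by
  rw [support_eq_insert_map_derivative g h0, Finset.filter_insert, if_pos (Nat.succ_pos i),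
    Finset.card_insert_of_notMem (by simp), Finset.filter_map, Finset.card_map]
  congr 2
  apply Finset.filter_congr
  intro e _
  simp only [Function.comp_apply, Function.Embedding.coeFn_mk]
  omega

/-! ### The inductive step -/

/-- From the derivative: for `g(0) ≠ 0` with `k` nonzero coefficients and `i ∈ supp g`, `i > 0`, of rank `j`:
`i · |c_i| ≤ binom(k-2, j-1) · deg g · M(g)`, given the theorem for `k - 1` nonzero coefficients.
[cite: AkhtariVaaler2019, Theorem 1.1 (= McKee–Smyth Thm 11.4 p.194)] -/
theorem natCast_mul_norm_coeff_le {k : ℕ}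
    (ih : ∀ m < k, ∀ p : ℂ[X], p.support.card = m → ∀ i ∈ p.support,
      ‖p.coeff i‖ ≤ ((m - 1).choose ((p.support.filter (· < i)).card) : ℝ) * p.mahlerMeasure)
    (g : ℂ[X]) (hg0 : g.coeff 0 ≠ 0) (hcard : g.support.card = k) {i : ℕ} (hi : i ∈ g.support) (hipos : 0 < i) :
    (i : ℝ) * ‖g.coeff i‖ ≤
      ((k - 2).choose ((g.support.filter (· < i)).card - 1) : ℝ) * (g.natDegree * g.mahlerMeasure) := by
  obtain ⟨j, rfl⟩ : ∃ j, i = j + 1 := ⟨i - 1, by omega⟩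
  have hcard' : g.derivative.support.card = k - 1 := by
    have := card_support_derivative_add_one g hg0
    omega
  have hmem : j ∈ g.derivative.support := mem_support_derivative.2 hi
  have hrank : (g.derivative.support.filter (· < j)).card = (g.support.filter (· < j + 1)).card - 1 := by
    have := rank_derivative_succ g hg0 j
    omega
  have hk1 : 1 ≤ k := by
    rw [← hcard]
    exact Finset.card_pos.2 ⟨_, hi⟩
  have h1 := ih (k - 1) (by omega) g.derivative hcard' j hmem
  have e : k - 1 - 1 = k - 2 := by omega
  rw [hrank, coeff_derivative, norm_mul, e] at h1
  have hcast : ‖((j : ℂ) + 1)‖ = (j : ℝ) + 1 := by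
    have := Complex.norm_natCast (j + 1)
    push_cast at this
    exact this
  rw [hcast] at h1
  have h2 : g.derivative.mahlerMeasure ≤ g.natDegree * g.mahlerMeasure := mahlerMeasure_derivative_le g
  calc ((j + 1 : ℕ) : ℝ) * ‖g.coeff (j + 1)‖ = ‖g.coeff (j + 1)‖ * ((j : ℝ) + 1) := by push_cast; ring
    _ ≤ ((k - 2).choose ((g.support.filter (· < j + 1)).card - 1) : ℝ) * g.derivative.mahlerMeasure := h1
    _ ≤ ((k - 2).choose ((g.support.filter (· < j + 1)).card - 1) : ℝ) * (g.natDegree * g.mahlerMeasure) :=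
        mul_le_mul_of_nonneg_left h2 (by positivity)

/-- The theorem for `g` with `g(0) ≠ 0`, given the theorem for fewer nonzero coefficients.
[cite: AkhtariVaaler2019, Theorem 1.1 (= McKee–Smyth Thm 11.4 p.194)] -/
theorem norm_coeff_le_choose_of_coeff_zero_ne {k : ℕ}
    (ih : ∀ m < k, ∀ p : ℂ[X], p.support.card = m → ∀ i ∈ p.support,
      ‖p.coeff i‖ ≤ ((m - 1).choose ((p.support.filter (· < i)).card) : ℝ) * p.mahlerMeasure)
    (g : ℂ[X]) (hg0 : g.coeff 0 ≠ 0) (hcard : g.support.card = k) {i : ℕ} (hi : i ∈ g.support) :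
    ‖g.coeff i‖ ≤ ((k - 1).choose ((g.support.filter (· < i)).card) : ℝ) * g.mahlerMeasure := by
  set r := (g.support.filter (· < i)).card with hr
  set N := g.natDegree with hN
  have hg : g ≠ 0 := fun h => hg0 (by rw [h, coeff_zero])
  have hM : 0 ≤ g.mahlerMeasure := mahlerMeasure_nonneg g
  have hiN : i ≤ N := le_natDegree_of_mem_supp i hi
  have hpart := rank_add_rank_above_add_one hi
  -- the constant coefficient (rank 0)
  rcases Nat.eq_zero_or_pos i with hi0 | hipos
  · have hr0 : r = 0 := by
      rw [hr, Finset.card_eq_zero, hi0]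
      ext e
      simp
    rw [hr0, Nat.choose_zero_right, Nat.cast_one, one_mul, hi0]
    have := norm_coeff_le_choose_mul_mahlerMeasure 0 g
    simpa using this
  -- the leading coefficient (rank `k - 1`)
  rcases hiN.eq_or_lt with hiN' | hiN'
  · have ha0 : (g.support.filter (i < ·)).card = 0 := by
      rw [Finset.card_eq_zero]
      ext e
      simp only [Finset.mem_filter, Finset.notMem_empty, iff_false, not_and, not_lt]
      intro he
      rw [hiN']
      exact le_natDegree_of_mem_supp e he
    have hrk : r = k - 1 := by rw [hr]; omega
    rw [hrk, Nat.choose_self, Nat.cast_one, one_mul, hiN', hN]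
    have := norm_coeff_le_choose_mul_mahlerMeasure g.natDegree g
    simpa using this
  -- a middle coefficient: `0 < i < N`, rank `1 ≤ r ≤ k - 2`
  have hr1 : 1 ≤ r := by
    rw [hr]
    apply Finset.card_pos.2
    exact ⟨0, Finset.mem_filter.2 ⟨mem_support_iff.2 hg0, hipos⟩⟩
  have ha1 : 1 ≤ (g.support.filter (i < ·)).card := by
    apply Finset.card_pos.2
    refine ⟨N, Finset.mem_filter.2 ⟨?_, hiN'⟩⟩
    rw [mem_support_iff, hN, coeff_natDegree]
    exact leadingCoeff_ne_zero.2 hg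
  have hrk : r ≤ k - 2 := by omega
  have hk3 : 3 ≤ k := by omega
  -- (1) from `g'`
  have h1 := natCast_mul_norm_coeff_le ih g hg0 hcard hi hipos
  rw [← hr] at h1
  -- (2) from `(reverse g)'`
  have htr : g.natTrailingDegree = 0 := Nat.le_zero.1 (natTrailingDegree_le_of_ne_zero hg0)
  have hrn : g.reverse.natDegree = N := by rw [reverse_natDegree, htr, Nat.sub_zero]
  have hr0 : g.reverse.coeff 0 ≠ 0 := by
    rw [coeff_zero_reverse]
    exact leadingCoeff_ne_zero.2 hg
  have hrc : g.reverse.coeff (N - i) = g.coeff i := by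
    rw [coeff_reverse, revAt_le (Nat.sub_le N i), Nat.sub_sub_self hiN]
  have hmem' : N - i ∈ g.reverse.support := by
    rw [mem_support_iff, hrc]
    exact mem_support_iff.1 hi
  have hrank' : (g.reverse.support.filter (· < N - i)).card = (g.support.filter (i < ·)).card :=
    rank_reverse g i hiN
  have h2 := natCast_mul_norm_coeff_le ih g.reverse hr0 ((card_support_reverse g).trans hcard) hmem' (by omega)
  rw [hrank', hrc, hrn, mahlerMeasure_reverse, show (g.support.filter (i < ·)).card - 1 = k - 2 - r by omega,
    Nat.choose_symm hrk, Nat.cast_sub hiN] at h2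
  -- add, with Pascal's rule
  have hpas : ((k - 1).choose r : ℝ) = ((k - 2).choose (r - 1) : ℝ) + ((k - 2).choose r : ℝ) := by
    have := Nat.choose_succ_succ' (k - 2) (r - 1)
    rw [show k - 2 + 1 = k - 1 by omega, show r - 1 + 1 = r by omega] at this
    exact_mod_cast this
  have hNpos : (0 : ℝ) < N := by exact_mod_cast (lt_of_lt_of_le hipos hiN)
  have key : (N : ℝ) * ‖g.coeff i‖ ≤ (N : ℝ) * (((k - 1).choose r : ℝ) * g.mahlerMeasure) := by
    have := add_le_add h1 h2
    rw [hpas]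
    nlinarith
  exact le_of_mul_le_mul_left key hNpos

/-- **Akhtari–Vaaler / McKee–Smyth Theorem 11.4 (complex coefficients):** if `f ∈ ℂ[X]` has `k` nonzero coefficients
`c_0, …, c_{k-1}` (by increasing exponent) then `|c_j| ≤ binom(k-1, j) · M(f)`; here `i ∈ supp f` has rank
`j = #{e ∈ supp f : e < i}`.  REPLICATION of [cite: AkhtariVaaler2019, Theorem 1.1] (= [cite: MckeeSmyth2021, Theorem 11.4]). -/
theorem norm_coeff_le_choose_mul_mahlerMeasure (f : ℂ[X]) {i : ℕ} (hi : i ∈ f.support) :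
    ‖f.coeff i‖ ≤ ((f.support.card - 1).choose ((f.support.filter (· < i)).card) : ℝ) * f.mahlerMeasure := by
  suffices H : ∀ k : ℕ, ∀ f : ℂ[X], f.support.card = k → ∀ i ∈ f.support,
      ‖f.coeff i‖ ≤ ((k - 1).choose ((f.support.filter (· < i)).card) : ℝ) * f.mahlerMeasure from H _ f rfl i hi
  intro k
  induction k using Nat.strong_induction_on with
  | _ k ih =>
  intro f hk i hi
  have hfi : f.coeff i ≠ 0 := mem_support_iff.1 hi
  have hf : f ≠ 0 := fun h => hfi (by rw [h, coeff_zero])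
  obtain ⟨g, hfg, hndvd⟩ := exists_eq_pow_rootMultiplicity_mul_and_not_dvd f hf 0
  simp only [map_zero, sub_zero] at hfg hndvd
  set r := rootMultiplicity 0 f with hr
  have hg0 : g.coeff 0 ≠ 0 := fun h => hndvd (X_dvd_iff.2 h)
  have hcard : g.support.card = k := by rw [← hk, hfg, card_support_X_pow_mul_complex]
  have hri : r ≤ i := by
    by_contra hlt
    push Not at hlt
    apply hfi
    rw [hfg, coeff_X_pow_mul', if_neg (not_le.2 hlt)]
  have hcoef : f.coeff i = g.coeff (i - r) := by rw [hfg, coeff_X_pow_mul', if_pos hri]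
  have hi' : i - r ∈ g.support := by
    rw [mem_support_iff, ← hcoef]
    exact hfi
  have hrank : (f.support.filter (· < i)).card = (g.support.filter (· < i - r)).card := by
    rw [hfg, ← rank_X_pow_mul r g (i - r), Nat.sub_add_cancel hri]
  rw [hcoef, hrank, hfg, mahlerMeasure_X_pow_mul]
  exact norm_coeff_le_choose_of_coeff_zero_ne ih g hg0 hcard hi'

/-- **Dobrowolski–Smyth 2017, Theorem 1 (complex coefficients, coefficientwise):** every coefficient of `f ∈ ℂ[X]`
with `k` nonzero coefficients satisfies `|a_i| ≤ 2^{k-2} · M(f)` (exponent in `ℕ`; `binom(k-1, j) ≤ 2^{k-2}`).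
Equivalently `M(f) ≥ h(f)/2^{k-2}`.  REPLICATION of [cite: DobrowolskiSmyth2017, Theorem 1]. -/
theorem norm_coeff_le_two_pow_mul_mahlerMeasure (f : ℂ[X]) (i : ℕ) :
    ‖f.coeff i‖ ≤ 2 ^ (f.support.card - 2) * f.mahlerMeasure := by
  have hM : 0 ≤ f.mahlerMeasure := mahlerMeasure_nonneg f
  by_cases hi : i ∈ f.support
  · refine (norm_coeff_le_choose_mul_mahlerMeasure f hi).trans (mul_le_mul_of_nonneg_right ?_ hM)
    have hk : 1 ≤ f.support.card := Finset.card_pos.2 ⟨i, hi⟩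
    rcases hk.eq_or_lt with hk1 | hk2
    · rw [← hk1]
      have : (f.support.filter (· < i)).card = 0 := by
        have := rank_lt_card hi
        omega
      rw [this]
      norm_num
    · have h := choose_le_two_pow_pred (n := f.support.card - 1) (by omega) ((f.support.filter (· < i)).card)
      rw [show f.support.card - 1 - 1 = f.support.card - 2 by omega] at h
      exact_mod_cast h
  · rw [notMem_support_iff.1 hi, norm_zero]
    positivity

/-! ### Integer coefficients: the Literature named fact, and the census reading -/

/-- Cast bookkeeping: `natAbs` of an integer is the modulus of its image in `ℂ`.
[cite: AkhtariVaaler2019, Theorem 1.1 (= McKee–Smyth Thm 11.4 p.194)] -/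
theorem natAbs_cast_eq_norm_intCast (m : ℤ) : ((m.natAbs : ℕ) : ℝ) = ‖((m : ℤ) : ℂ)‖ := by
  rw [Complex.norm_intCast, ← Int.cast_natCast, Int.natCast_natAbs, Int.cast_abs]

/-- Dobrowolski–Smyth for integer polynomials, coefficientwise: `|a_i| ≤ 2^{k-2} M(f)`.
[cite: AkhtariVaaler2019, Theorem 1.1 (= McKee–Smyth Thm 11.4 p.194)] -/
theorem natAbs_coeff_le_two_pow_mul_mahlerMeasure (f : ℤ[X]) (i : ℕ) :
    ((f.coeff i).natAbs : ℝ) ≤ 2 ^ (f.support.card - 2) * (f.map (Int.castRingHom ℂ)).mahlerMeasure := by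
  have h := norm_coeff_le_two_pow_mul_mahlerMeasure (f.map (Int.castRingHom ℂ)) i
  rw [support_map_of_injective _ (RingHom.injective_int _), coeff_map] at h
  rw [natAbs_cast_eq_norm_intCast]
  exact h

end Literature.NumberTheory.MahlerMeasure

end Part3

/-! ## Part 4 — the EXACT discharge(s) -/

namespace Literature.NumberTheory.MahlerMeasure

/-- **The Literature named fact `FewnomialHeightMahlerBound` HOLDS** — Dobrowolski–Smyth 2017, Theorem 1 (integer case): a
nonzero `f ∈ ℤ[X]` with `k ≥ 2` nonzero coefficients has `h(f)/2^{k−2} ≤ M(f)`.  EXACT discharge, Literature-side twin of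
`Summit.Ventures.DiscreteObjects.Mahler.fewnomialHeightMahlerBound_holds` (same proof).
(McKee–Smyth Theorem 11.4 gives the sharper binomial form.) [cite: DobrowolskiSmyth2017, Theorem 1] -/
theorem FewnomialHeightMahlerBound_holds : FewnomialHeightMahlerBound := by
  intro f hk
  have hne : f.support.Nonempty := by
    rw [← Finset.card_pos]
    omega
  obtain ⟨i₀, -, hsup⟩ := Finset.exists_mem_eq_sup f.support hne (fun i => (f.coeff i).natAbs)
  rw [hsup, div_le_iff₀ (by positivity), mul_comm]
  exact natAbs_coeff_le_two_pow_mul_mahlerMeasure f i₀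

end Literature.NumberTheory.MahlerMeasure

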